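import Summits.BirchSwinnertonDyer.Rank1Residual.X11b.KolyvaginCasselsTateLocalTerm
import Literature.NumberTheory.EllipticCurves.HeegnerPointsKolyvaginPrimaryProp82TwistedProofs
import Literature.NumberTheory.EllipticCurves.HeegnerPointsKolyvaginPrimaryShaBoundProofs
import HarnessLib

/-!
# McCallum's Lemma 5.3 for the Cassels–Tate local term (`hloc`), and Kolyvagin's bound assembled
# (cell `b2b-bsdres`, team x11b3, seat p2 GEN 40, (P2-ORDER-UB) F4f)

HONEST FRAMING (cell `b2b-bsdres`, run/shared/lean/b2b/bsd-rank1-residual/, verbatim in every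
file): the goal of the cell is to DELETE the COMBINATION-SHAPED residual classes of the
Birch–Swinnerton-Dyer formula for ALL analytic-rank `≤ 1` elliptic curves over `ℚ` — "full BSD
formula for every rank `≤ 1` curve in class `C`" assembled STRICTLY from published theorems — so
that the rank-`≤ 1` remainder becomes exactly the CONSTRUCTION-SHAPED classes, which are TYPED
(missing-input `Prop`s), NOT attempted. This is not "finishing BSD". Plumbing on the PUBLISHED
Kolyvagin ORDER bound (McCallum 1991 §1 Theorem / Cor. 5.6). TWO THEOREMS (no definition, no named
fact, no `sorry`); nothing booked; no mark / label / count / tier moved.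

* `hloc_of_localDuality` — the hypothesis `hloc` of
  `KolyvaginDescent.card_quotient_selmer_le_of_localTerm` /
  `card_sha_primaryComponent_le_of_localTerm` (McCallum's Lemma 5.3 for the Cassels–Tate local term
  at a Kolyvagin prime `λ`: `inv_λ((loc_λ D.b₁ - β_λ) ∪ β'_λ) ≠ 0` for the first-case data of a
  Kolyvagin pair) **discharged** from: the Weil pairing `e` on `E[p^{2M₀}]` being alternating AND
  non-degenerate, the local invariant maps `inv_v` being injective at the finite places (both hold
  for the class-field-theoretic family and the genuine Weil pairing), leaf (A) `hcl` (McCallum (6),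
  Lemma 4.3, Prop. 4.4), `K` imaginary quadratic with conjugation `c` and a Heegner point (good
  reduction at Kolyvagin primes). Proof: `KolyvaginCT.exists_twisted_value_of_localTerm_eq_zero`
  (the vanishing local term gives `e(P', [D.b₁, σ]) = 1` with `p^{M₀} P' = [t, F]`), rescaled to the
  class `cl(ℓm)` (`D.b₁ = p^{j-M₀} cl(ℓm)`) and fed to `lemma_5_3_descent_of_reciprocity_twisted`
  with `k = 2M₀ - j`, `s = p^{(j-2M₀)⁺} t`, `a ↦ a + (j - N)`; the output `p^b t ∈ ker(… → H¹(K_λ, ·))`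
  contradicts the hypothesis of `hloc`. The degenerate range `a + (j - N) ≥ 2M₀` is vacuous
  (`p^{2M₀}` kills `H¹(K, E[p^{2M₀}])`).
* `card_sha_primaryComponent_le_of_localDuality` — McCallum 1991 §1 Theorem (order form, upper
  bound) with `hloc` discharged by the theorem above: `Ш(E/K)[p^∞]` finite, killed by `p^{M₀}`,
  `#Ш(E/K)[p^∞] ≤ p^{2M₀}`, `ord_p #Ш(E/K)[p^∞] ≤ 2M₀`, GRANTED the displayed inputs of
  `card_sha_primaryComponent_le_of_localTerm` minus `hloc`, plus `hnondeg` (Weil pairing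
  non-degenerate) and `hinv` (injective local invariants).

References (locators only): [cite: McCallumLMS1991, §1 Theorem, §5 Lemma 5.3, Thm. 5.4, Cor. 5.6]
[cite: GrossLMS1991, §7 (7.6), Prop. 8.2, §9] [cite: MilneADT2006, Ch. I §6, Prop. 6.9, Thm. 6.13(a)].
-/

noncomputable section

open scoped Classical Pointwise

namespace Summit.BirchSwinnertonDyer.Rank1Residual.X11b.KolyvaginCT
open WeierstrassCurve NumberField IsDedekindDomain Field Function
open Literature.NumberTheory.EllipticCurves Literature.NumberTheory.EllipticCurves.KolyvaginDescent
open Literature.NumberTheory.GaloisRepresentations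
open Literature.NumberTheory.GaloisCohomology
open Literature.NumberTheory.GaloisRepresentations.DiscreteGaloisModule (mu MuCarrier)

-- Cup products need `LocallyCompactSpace Γ_K`; as in the tree's Cassels–Tate files.
attribute [local instance] absoluteGaloisGroup_compactSpace

-- `CharZero` of the completions (the Cassels–Tate local terms), as in the tree's files.
attribute [local instance] charZero_placeCompletion

variable (W : WeierstrassCurve ℚ) {K : Type} [Field K] [NumberField K]

/-- **`hloc` from local duality** (McCallum's Lemma 5.3 for the Cassels–Tate local term at a
Kolyvagin prime; module docstring): the hypothesis `hloc` of
`KolyvaginDescent.card_quotient_selmer_le_of_localTerm`, for `e` alternating and non-degenerate and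
`inv_v` injective at the finite places. [cite: McCallumLMS1991, §5 Lemma 5.3, Thm. 5.4]
[cite: GrossLMS1991, §7 (7.6), Prop. 8.2] [cite: MilneADT2006, Ch. I §6, proof of Prop. 6.9] -/
theorem hloc_of_localDuality [W.IsElliptic] (hK : IsImaginaryQuadratic K)
    {N₀ : ℕ} [NeZero N₀] {Pt : (W.baseChange K).toAffine.Point} (hP : IsHeegnerPoint N₀ W K Pt)
    {p : ℕ} (hp : p.Prime) (hp2 : p ≠ 2) {M₀ : ℕ} (hM₀ : 1 ≤ M₀) [NeZero (p ^ M₀)]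
    {c : K ≃ₐ[ℚ] K} (hc : c ≠ 1) (ε : ℤ) (hε : ε = 1 ∨ ε = -1)
    (cl : ℕ → galH1Torsion (W.baseChange K) ((p ^ M₀ * p ^ M₀ : ℕ) : ℤ))
    (hcl : ∀ m : ℕ, Squarefree m →
      (∀ q ∈ m.primeFactors, IsKolyvaginPrime N₀ W K p q ∧ FrobEqFrobInfty W K (p ^ M₀ * p ^ M₀) q) →
      conjAct W c _ (cl m) = (ε * (-1) ^ m.primeFactors.card) • cl m ∧
      (∀ v : HeightOneSpectrum (𝓞 K), (m : 𝓞 K) ∉ v.asIdeal →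
        cl m ∈ selmerLocalKer (W.baseChange K) (v.adicCompletion K) ((p ^ M₀ * p ^ M₀ : ℕ) : ℤ)) ∧
      (∀ ℓ : ℕ, ℓ.Prime → ℓ ∣ m → ∀ v : HeightOneSpectrum (𝓞 K), (ℓ : 𝓞 K) ∈ v.asIdeal →
        ∀ a : ℕ, (((p : ℤ) ^ a) • cl m ∈
            selmerLocalKer (W.baseChange K) (v.adicCompletion K) ((p ^ M₀ * p ^ M₀ : ℕ) : ℤ) ↔
          ((p : ℤ) ^ a) • cl (m / ℓ) ∈
            (W.baseChange K).torsionLocalKer (v.adicCompletion K) ((p ^ M₀ * p ^ M₀ : ℕ) : ℤ))))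
    (e : geomTorsion (W.baseChange K) ((p ^ M₀ * p ^ M₀ : ℕ) : ℤ) →
      geomTorsion (W.baseChange K) ((p ^ M₀ * p ^ M₀ : ℕ) : ℤ) → AlgebraicClosure K)
    (hμ : ∀ S T, e S T ^ (p ^ M₀ * p ^ M₀) = 1)
    (hadd₁ : ∀ S₁ S₂ T, e (S₁ + S₂) T = e S₁ T * e S₂ T)
    (hadd₂ : ∀ S T₁ T₂, e S (T₁ + T₂) = e S T₁ * e S T₂)
    (hgal : ∀ (σ : absoluteGaloisGroup K) (S T : geomTorsion (W.baseChange K) ((p ^ M₀ * p ^ M₀ : ℕ) : ℤ)),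
      σ • e S T = e (σ • S) (σ • T))
    (halt : ∀ T, e T T = 1) (hnondeg : ∀ T, (∀ S, e S T = 1) → T = 0)
    (inv : LocalInvariants K (p ^ M₀ * p ^ M₀))
    (hinv : ∀ v : HeightOneSpectrum (𝓞 K), Injective (inv (Sum.inr v))) :
    ∀ ℓ m : ℕ,
      (hℓ : IsKolyvaginPrime N₀ W K p ℓ ∧ FrobEqFrobInfty W K (p ^ M₀ * p ^ M₀) ℓ) →
      KolSupp (fun q => IsKolyvaginPrime N₀ W K p q ∧ FrobEqFrobInfty W K (p ^ M₀ * p ^ M₀) q) (ℓ * m) →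
      ¬ ℓ ∣ m →
      ∀ (j N a b : ℕ) (t : galH1Torsion (W.baseChange K) ((p ^ M₀ * p ^ M₀ : ℕ) : ℤ)),
      t ∈ selmerGroup (W.baseChange K) ((p ^ M₀ * p ^ M₀ : ℕ) : ℤ) →
      ((p : ℤ) ^ j) • cl (ℓ * m) ∈ selmerGroup (W.baseChange K) ((p ^ M₀ * p ^ M₀ : ℕ) : ℤ) →
      ((p : ℤ) ^ N) • t = 0 →
      conjAct W c ((p ^ M₀ * p ^ M₀ : ℕ) : ℤ) t = (ε * (-1) ^ (ℓ * m).primeFactors.card) • t →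
      (∀ q ∈ m.primeFactors, ∀ v : HeightOneSpectrum (𝓞 K), (q : 𝓞 K) ∈ v.asIdeal →
        t ∈ (W.baseChange K).torsionLocalKer (v.adicCompletion K) ((p ^ M₀ * p ^ M₀ : ℕ) : ℤ)) →
      M₀ ≤ j → N ≤ M₀ → N ≤ j → a + b + 1 = N →
      (¬ ∀ v : HeightOneSpectrum (𝓞 K), (ℓ : 𝓞 K) ∈ v.asIdeal →
        ((p : ℤ) ^ (a + (j - N))) • cl m ∈
          (W.baseChange K).torsionLocalKer (v.adicCompletion K) ((p ^ M₀ * p ^ M₀ : ℕ) : ℤ)) →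
      (¬ ∀ v : HeightOneSpectrum (𝓞 K), (ℓ : 𝓞 K) ∈ v.asIdeal →
        ((p : ℤ) ^ b) • t ∈ (W.baseChange K).torsionLocalKer (v.adicCompletion K) ((p ^ M₀ * p ^ M₀ : ℕ) : ℤ)) →
      ∀ D : FirstCaseData (W.baseChange K) (p ^ M₀), D.b₁ = ((p : ℤ) ^ (j - M₀)) • cl (ℓ * m) →
        galoisCohomology.map (inclKD (W.baseChange K) (p ^ M₀) (p ^ M₀)) 1 D.b' = t →
        D.localTerm e hμ hadd₁ hadd₂ hgal inv (Sum.inr hℓ.1.place) ≠ 0 := by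
  intro ℓ m hℓ hsupp _hℓm j N a b t ht _hz hNt hτt _htq hMj hNM hNj hab hclm htb D hDb₁ hDb' hD0
  haveI : Fact p.Prime := ⟨hp⟩
  have hn2 : p ^ M₀ * p ^ M₀ = p ^ (2 * M₀) := by rw [two_mul, pow_add]
  -- good reduction at `λ`, `m² ∉ λ`
  have hgood : (W.baseChange K).HasGoodReductionAt hℓ.1.place := by
    have h := hℓ.1.not_mem_badPlaces hP
    rwa [WeierstrassCurve.mem_badPlaces_iff, not_not] at h
  have hpv : ((p : ℕ) : 𝓞 K) ∉ hℓ.1.place.asIdeal :=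
    not_natCast_mem_of_prime_ne hℓ.1.prime hp hℓ.1.2.2.2.1 hℓ.1.place hℓ.1.mem_place
  have hqv : ((((p ^ M₀ * p ^ M₀ : ℕ) : ℤ)) : 𝓞 K) ∉ hℓ.1.place.asIdeal := by
    rw [Int.cast_natCast, Nat.cast_mul, Nat.cast_pow]
    intro h
    rcases hℓ.1.place.isPrime.mem_or_mem h with h1 | h1 <;>
      exact hpv (hℓ.1.place.isPrime.mem_of_pow_mem _ h1)
  -- the sign `ν = ε (-1)^{ω(ℓm)}`
  have hν1 : ε * (-1) ^ (ℓ * m).primeFactors.card = 1 ∨ ε * (-1) ^ (ℓ * m).primeFactors.card = -1 := by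
    rcases hε with rfl | rfl <;> rcases neg_one_pow_eq_or ℤ (ℓ * m).primeFactors.card with h | h <;>
      simp [h]
  -- the vacuous range: `p^{a + (j - N)} cl(m) = 0` when `a + (j - N) ≥ 2M₀`
  by_cases hbig : 2 * M₀ ≤ a + (j - N)
  · refine hclm fun v _ => ?_
    have h0 : ((p : ℤ) ^ (a + (j - N))) • cl m = 0 := by
      obtain ⟨r, hr⟩ : ∃ r, a + (j - N) = 2 * M₀ + r := ⟨_, (Nat.add_sub_cancel' hbig).symm⟩
      have hs : (p : ℤ) ^ (a + (j - N)) = (p : ℤ) ^ r * ((p ^ M₀ * p ^ M₀ : ℕ) : ℤ) := by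
        rw [hr]; push_cast; ring
      have ht0 : (((p ^ M₀ * p ^ M₀ : ℕ) : ℤ)) • cl m = 0 := by
        have h := zsmul_discreteH1_torsion ((p ^ M₀ * p ^ M₀ : ℕ) : ℤ) (cl m)
        exact_mod_cast h
      rw [hs, mul_smul, ht0, zsmul_zero]
    rw [h0]
    exact zero_mem _
  push Not at hbig
  -- `p^{a + (j - N)} cl(ℓm)` is not Selmer at `λ` (McCallum Prop. 4.4, clause of `hcl`)
  have hdv : ((p : ℤ) ^ (a + (j - N))) • cl (ℓ * m) ∉
      selmerLocalKer (W.baseChange K) (hℓ.1.place.adicCompletion K) ((p ^ M₀ * p ^ M₀ : ℕ) : ℤ) := by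
    intro hsel
    refine hclm fun v hv => ?_
    rw [hℓ.1.mem_iff.mp hv]
    have key := (hcl (ℓ * m) hsupp.1 hsupp.2).2.2 ℓ hℓ.1.prime (dvd_mul_right ℓ m) hℓ.1.place
      hℓ.1.mem_place (a + (j - N))
    rw [Nat.mul_div_cancel_left m hℓ.1.prime.pos] at key
    exact key.mp hsel
  -- the twisted reciprocity value from the vanishing local term
  have hTw := exists_twisted_value_of_localTerm_eq_zero N₀ W K hp hM₀ rfl hℓ.1 hgood e hμ hadd₁ hadd₂
    hgal halt hnondeg inv (hinv _) D hDb' hD0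
  -- the rescaled Selmer class `s' = p^{(j - 2M₀)⁺} t` and the twist `k = (2M₀ - j)⁺`
  set r := j - 2 * M₀ with hrdef
  set k := 2 * M₀ - j with hkdef
  set s' := ((p : ℤ) ^ r) • t with hs'def
  have hs' : s' ∈ selmerGroup (W.baseChange K) ((p ^ M₀ * p ^ M₀ : ℕ) : ℤ) :=
    (selmerGroup (W.baseChange K) _).zsmul_mem ht _
  have hτs' : conjAct W c _ s' = (ε * (-1) ^ (ℓ * m).primeFactors.card) • s' := by
    rw [hs'def, map_zsmul, hτt, smul_smul, smul_smul, mul_comm ((p : ℤ) ^ r)]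
  have hd : conjAct W c _ (cl (ℓ * m)) = (ε * (-1) ^ (ℓ * m).primeFactors.card) • cl (ℓ * m) :=
    (hcl (ℓ * m) hsupp.1 hsupp.2).1
  have hka : k + (a + (j - N)) + 1 ≤ 2 * M₀ := by omega
  -- McCallum's Lemma 5.3, twisted
  have hmain := lemma_5_3_descent_of_reciprocity_twisted W hK hp hp2 hc hℓ.1 (M := 2 * M₀) (by omega)
    hn2 hℓ.2 hgood (weilPairingHom (W.baseChange K) (p ^ M₀ * p ^ M₀) e hμ hadd₁ hadd₂)
    (weilPairingHom_self (W.baseChange K) _ e hμ hadd₁ hadd₂ halt)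
    (TameCup.weilPairingHom_left_nondeg (W.baseChange K) _ e hμ hadd₁ hadd₂ halt hnondeg)
    hν1 hd hka hdv hs' hτs' ?_
  · -- `p^b t = p^{2M₀ - 1 - (a + (j - N)) - k} s'` dies at `λ`: contradiction
    refine htb fun v hv => ?_
    rw [hℓ.1.mem_iff.mp hv]
    have hexp : ((p : ℤ) ^ b) • t = ((p : ℤ) ^ (2 * M₀ - 1 - (a + (j - N)) - k)) • s' := by
      rw [hs'def, smul_smul, ← pow_add (p : ℤ), show 2 * M₀ - 1 - (a + (j - N)) - k + r = b by omega]
    rw [hexp]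
    exact hmain
  -- the twisted reciprocity input
  intro 𝔔 h𝔔 F hF hFfix σ hσ
  obtain ⟨P', hP', heP'⟩ := hTw 𝔔 h𝔔 F hF hFfix σ hσ
  have hσfix : σ ∈ torsionFixing (W.baseChange K) ((p ^ M₀ * p ^ M₀ : ℕ) : ℤ) :=
    (mem_torsionFixing_iff _ _).mpr fun Q =>
      (W.baseChange K).smul_geomTorsion_eq_of_mem_inertia hgood hqv h𝔔 hσ Q
  refine ⟨(p ^ (j - M₀)) • P', ?_, ?_⟩
  · rw [smul_smul, ← pow_add p k (j - M₀), show k + (j - M₀) = r + M₀ by omega, pow_add p r M₀,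
      ← smul_smul, hP',
      hs'def, h1Eval_zsmul _ _ _ _ hFfix, ← Nat.cast_pow, natCast_zsmul]
  · rw [← natCast_zsmul, KolyvaginEigenPow.pairing_zsmul_left, ← map_zsmul, Nat.cast_pow,
      ← h1Eval_zsmul _ _ _ _ hσfix, ← hDb₁, TameCup.weilPairingHom_eq_zero_iff]
    exact heP'

/-- **Kolyvagin's bound on `Ш(E/K)[p^∞]`, order form, with `hloc` discharged by local duality**
(McCallum 1991 §1 Theorem (Kolyvagin) / Cor. 5.6 = Gross 1991 Thm. 2.2 (2) at one odd prime `p`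
with `ρ̄_{E,p}` onto, UPPER BOUND): `Ш(E/K)[p^∞]` is finite, killed by `p^{M₀}`, of order
`≤ p^{2M₀}`, so `ord_p #Ш(E/K)[p^∞] ≤ 2M₀` — GRANTED exactly the displayed inputs of
`KolyvaginDescent.card_sha_primaryComponent_le_of_localTerm` with its hypothesis `hloc` REPLACED by
`hnondeg` (the Weil pairing `e` is non-degenerate) and `hinv` (the local invariant maps are
injective at the finite places); `hloc` is `hloc_of_localDuality`. Plumbing; nothing discharged
beyond `hloc`. [cite: McCallumLMS1991, §1 Theorem, §5 Lemma 5.3, Thm. 5.4, Cor. 5.6]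
[cite: GrossLMS1991, §2 Thm. 2.2 (2), §7 (7.6)] [cite: MilneADT2006, Ch. I §6, Prop. 6.9, Thm. 6.13(a)] -/
theorem card_sha_primaryComponent_le_of_localDuality [W.IsElliptic] (hK : IsImaginaryQuadratic K)
    {N₀ : ℕ} [NeZero N₀] {Pt : (W.baseChange K).toAffine.Point} (hP : IsHeegnerPoint N₀ W K Pt)
    {p : ℕ} (hp : p.Prime) (hp2 : p ≠ 2) (hρ : W.HasSurjectiveModNGaloisRep p)
    (hC : Literature.NumberTheory.Automorphic.chebotarev_artinRep) (hW : W.exists_weilPairing p)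
    {M₀ : ℕ} (hM₀ : 1 ≤ M₀) [NeZero (p ^ M₀)]
    (hdiv : ∀ Q : geomPoints (W.baseChange K), ∃ R, ((p ^ M₀ * p ^ M₀ : ℕ) : ℤ) • R = Q)
    {c : K ≃ₐ[ℚ] K} (hc : c ≠ 1) (hcc : c * c = 1)
    {x₀ : (W.baseChange K).toAffine.Point} (hx₀ : p ^ M₀ • x₀ = Pt)
    (hPx : kummerMapTorsion (W.baseChange K) _ hdiv Pt =
      ((p : ℤ) ^ M₀) • kummerMapTorsion (W.baseChange K) _ hdiv x₀)
    (hxord : ((p : ℤ) ^ (2 * M₀ - 1)) • kummerMapTorsion (W.baseChange K) _ hdiv x₀ ≠ 0)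
    (ε : ℤ) (hε : ε = 1 ∨ ε = -1)
    (h53 : IsOfFinAddOrder (Affine.Point.map (W' := W) (c : K →ₐ[ℚ] K) Pt - ε • Pt))
    (cl : ℕ → galH1Torsion (W.baseChange K) ((p ^ M₀ * p ^ M₀ : ℕ) : ℤ))
    (hc1 : cl 1 = kummerMapTorsion (W.baseChange K) _ hdiv Pt)
    (hcl : ∀ m : ℕ, Squarefree m →
      (∀ q ∈ m.primeFactors, IsKolyvaginPrime N₀ W K p q ∧ FrobEqFrobInfty W K (p ^ M₀ * p ^ M₀) q) →
      conjAct W c _ (cl m) = (ε * (-1) ^ m.primeFactors.card) • cl m ∧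
      (∀ v : HeightOneSpectrum (𝓞 K), (m : 𝓞 K) ∉ v.asIdeal →
        cl m ∈ selmerLocalKer (W.baseChange K) (v.adicCompletion K) ((p ^ M₀ * p ^ M₀ : ℕ) : ℤ)) ∧
      (∀ ℓ : ℕ, ℓ.Prime → ℓ ∣ m → ∀ v : HeightOneSpectrum (𝓞 K), (ℓ : 𝓞 K) ∈ v.asIdeal →
        ∀ a : ℕ, (((p : ℤ) ^ a) • cl m ∈
            selmerLocalKer (W.baseChange K) (v.adicCompletion K) ((p ^ M₀ * p ^ M₀ : ℕ) : ℤ) ↔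
          ((p : ℤ) ^ a) • cl (m / ℓ) ∈
            (W.baseChange K).torsionLocalKer (v.adicCompletion K) ((p ^ M₀ * p ^ M₀ : ℕ) : ℤ))))
    (hdual : ∀ ℓ : ℕ, IsKolyvaginPrime N₀ W K p ℓ ∧ FrobEqFrobInfty W K (p ^ M₀ * p ^ M₀) ℓ →
      ∀ ν : ℤ, (ν = 1 ∨ ν = -1) → ∀ d : galH1Torsion (W.baseChange K) ((p ^ M₀ * p ^ M₀ : ℕ) : ℤ),
      conjAct W c _ d = ν • d →
      (∀ v : HeightOneSpectrum (𝓞 K), (ℓ : 𝓞 K) ∉ v.asIdeal →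
        d ∈ selmerLocalKer (W.baseChange K) (v.adicCompletion K) ((p ^ M₀ * p ^ M₀ : ℕ) : ℤ)) →
      (∀ w : InfinitePlace K,
        d ∈ selmerLocalKer (W.baseChange K) w.Completion ((p ^ M₀ * p ^ M₀ : ℕ) : ℤ)) →
      ∀ s ∈ selmerGroup (W.baseChange K) ((p ^ M₀ * p ^ M₀ : ℕ) : ℤ), conjAct W c _ s = ν • s →
      ∀ a : ℕ, a < 2 * M₀ → ∀ v : HeightOneSpectrum (𝓞 K), (ℓ : 𝓞 K) ∈ v.asIdeal →
        ((p : ℤ) ^ a) • d ∉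
          selmerLocalKer (W.baseChange K) (v.adicCompletion K) ((p ^ M₀ * p ^ M₀ : ℕ) : ℤ) →
        ((p : ℤ) ^ (2 * M₀ - 1 - a)) • s ∈
          (W.baseChange K).torsionLocalKer (v.adicCompletion K) ((p ^ M₀ * p ^ M₀ : ℕ) : ℤ))
    -- the Cassels–Tate inputs at level `m = p^{M₀}`, auxiliary level `m² = p^M`
    (e : geomTorsion (W.baseChange K) ((p ^ M₀ * p ^ M₀ : ℕ) : ℤ) →
      geomTorsion (W.baseChange K) ((p ^ M₀ * p ^ M₀ : ℕ) : ℤ) → AlgebraicClosure K)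
    (hμ : ∀ S T, e S T ^ (p ^ M₀ * p ^ M₀) = 1)
    (hadd₁ : ∀ S₁ S₂ T, e (S₁ + S₂) T = e S₁ T * e S₂ T)
    (hadd₂ : ∀ S T₁ T₂, e S (T₁ + T₂) = e S T₁ * e S T₂)
    (hgal : ∀ (σ : absoluteGaloisGroup K) (S T : geomTorsion (W.baseChange K) ((p ^ M₀ * p ^ M₀ : ℕ) : ℤ)),
      σ • e S T = e (σ • S) (σ • T))
    (halt : ∀ T, e T T = 1) (hnondeg : ∀ T, (∀ S, e S T = 1) → T = 0)
    (inv : LocalInvariants K (p ^ M₀ * p ^ M₀)) (hPT' : inv.SumInvLocalizationEqZero)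
    (hinv : ∀ v : HeightOneSpectrum (𝓞 K), Injective (inv (Sum.inr v)))
    (hH3 : ∀ x : galoisCohomology (mu K (p ^ M₀ * p ^ M₀)) 3,
      (∀ v : Place K, galoisCohomology.localization (mu K (p ^ M₀ * p ^ M₀)) v 3 x = 0) → x = 0)
    (hB : Literature.GroupTheory.FiniteAbelian.IsLevelPairing (p ^ M₀)
      (ctLevelPairing (W.baseChange K) (p ^ M₀) e hμ hadd₁ hadd₂ hgal inv halt hPT' hH3
        (localTerm_finite_support (W := W.baseChange K) (m := p ^ M₀) (e := e) (hμ := hμ)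
          (hadd₁ := hadd₁) (hadd₂ := hadd₂) (hgal := hgal) halt inv)))
    (hPτ : ∀ z ∈ selmerGroup (W.baseChange K) ((p ^ M₀ * p ^ M₀ : ℕ) : ℤ),
      ∀ t ∈ selmerGroup (W.baseChange K) ((p ^ M₀ * p ^ M₀ : ℕ) : ℤ),
      ctGeneralFun (W.baseChange K) (p ^ M₀) e hμ hadd₁ hadd₂ hgal inv
          (torsionH1ToH1 (W.baseChange K) _ (conjAct W c _ z))
          (torsionH1ToH1 (W.baseChange K) _ (conjAct W c _ t)) =
        ctGeneralFun (W.baseChange K) (p ^ M₀) e hμ hadd₁ hadd₂ hgal inv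
          (torsionH1ToH1 (W.baseChange K) _ z) (torsionH1ToH1 (W.baseChange K) _ t))
    -- Kolyvagin's annihilation, in the two forms used
    (hkill : ∀ s ∈ selmerGroup (W.baseChange K) ((p ^ M₀ * p ^ M₀ : ℕ) : ℤ),
      ((p : ℤ) ^ M₀) • s ∈ AddSubgroup.zmultiples (kummerMapTorsion (W.baseChange K) _ hdiv x₀))
    (hL : ∀ a ∈ (W.baseChange K).sha,
      (((p ^ M₀ * p ^ M₀ : ℕ) : ℤ)) • a = 0 → ((p ^ M₀ : ℕ) : ℤ) • a = 0) :
    Finite (AddCommGroup.primaryComponent (W.baseChange K).sha p) ∧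
    (∀ c ∈ AddCommGroup.primaryComponent (W.baseChange K).sha p, p ^ M₀ • c = 0) ∧
    Nat.card (AddCommGroup.primaryComponent (W.baseChange K).sha p) ≤ p ^ (2 * M₀) ∧
    padicValNat p (Nat.card (AddCommGroup.primaryComponent (W.baseChange K).sha p)) ≤ 2 * M₀ :=
  card_sha_primaryComponent_le_of_localTerm W hK hP hp hp2 hρ hC hW hM₀ hdiv hc hcc hx₀ hPx hxord ε hε
    h53 cl hc1 hcl hdual e hμ hadd₁ hadd₂ hgal halt inv hPT' hH3 hB hPτ hkill hL
    (hloc_of_localDuality W hK hP hp hp2 hM₀ hc ε hε cl hcl e hμ hadd₁ hadd₂ hgal halt hnondeg inv hinv)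

end Summit.BirchSwinnertonDyer.Rank1Residual.X11b.KolyvaginCT

end
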